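import Summits.KontsevichZagierPeriods.KontsevichZagierPeriods.Theorems.HurwitzMicroSectorsNormalFormPrincipleM2FiveZetaTwo

/-!
# `NormalFormPrinciple` (stmt-KontsevichZagierPeriods-3869), line `SketchIdeator1` — leaf
# `stub_boxRigidity`, dimension two off the product type (`CatalanTwoWays`, disc side):
# the affine unfolding of the plus part (rule 2)

Registered sub-goal `discPlus_sub_logMonomial` of the layer `CatalanTwoWays` (disc side, lead file
`…M2`). Let `σ = {0 < x < 1} ⊆ ℝ¹` and `a = √(2 − x²) ∈ (1, √2)` for `x ∈ σ`. For any
representation `Dp` on the band-box `{0 < x < 1, 0 ≤ y ≤ 1} = KZlog.band σ 0 1` with integrand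
`1/(2a(a + y))` there, and any representation `Mp` on the band `{0 < x < 1, 1 ≤ t ≤ 1 + 1/a}` with
integrand `(1/(2a))/t` there (the unfolded "log monomial" `M(1/(2a), 1 + 1/a)`), the difference
`[Dp] − [Mp]` is a relation: it is ONE instance of Kontsevich–Zagier's rule (2), the affine
substitution `t = 1 + y/a` along the last coordinate over the open base `σ`
(`KZ.of_sub_of_mem_relations_of_affine` with `α = 1`, `β = 1/a > 0`, Jacobian `β`), since
`(1/(2a))/(1 + y/a) · (1/a) = 1/(2a(a + y))` and the edges `0 ≤ y ≤ 1` go to `1 ≤ t ≤ 1 + 1/a`.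

References: M. Kontsevich, D. Zagier, *Periods* (2001), §1.2, rule (2). No new definitions.
-/

noncomputable section

open MeasureTheory Set
open Literature.NumberTheory.Transcendental Literature.NumberTheory.Transcendental.KZ
open Literature.ModelTheory.ExponentialFields (IsSemialgebraic)

namespace Summit.KontsevichZagierPeriods.HurwitzMicroSectors.NormalFormPrinciple.PiBox.M2

/-- The pointwise identity behind the affine unfolding `t = 1 + y/a`:
`1/(2a(a + y)) = ((1/(2a))/(1 + (1/a) y)) · (1/a)` for `a > 0`, `y ≥ 0`. [folklore] -/
theorem discPlus_affine_identity {a t : ℝ} (ha : 0 < a) (ht : 0 ≤ t) :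
    1 / (2 * a * (a + t)) = 1 / (2 * a) / (1 + 1 / a * t) * (1 / a) := by
  have h1 : (a : ℝ) ≠ 0 := ha.ne'
  have h2 : (a + t : ℝ) ≠ 0 := by positivity
  have h3 : 1 + 1 / a * t = (a + t) / a := by
    field_simp
  rw [h3]
  field_simp

/-- On the open base `σ = (0,1)`, the radicand `2 − x²` of `a = √(2 − x²)` is positive.
[folklore] -/
theorem discPlus_radicand_pos {y : Fin 1 → ℝ} (hy : y ∈ {y : Fin 1 → ℝ | 0 < y 0 ∧ y 0 < 1}) :
    0 < 2 - y 0 ^ 2 := by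
  obtain ⟨h0, h1⟩ := hy
  nlinarith

/-- The coefficient `β = 1/√(2 − x²)` of the substitution `t = 1 + y/√(2 − x²)` is a
`ℚ`-semialgebraic function on the open base `σ = (0,1)` (polynomial, square root, inverse of a
non-vanishing function: Tarski–Seidenberg). [cite: KontsevichZagier2001, §1.2] -/
theorem isSemialgebraicFunOn_one_div_sqrt_two_sub_sq :
    IsSemialgebraicFunOn ℚ {y : Fin 1 → ℝ | 0 < y 0 ∧ y 0 < 1}
      (fun y => 1 / Real.sqrt (2 - y 0 ^ 2)) := by
  have hG : IsSemialgebraic ℚ {y : Fin 1 → ℝ | 0 < y 0 ∧ y 0 < 1} :=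
    isSemialgebraic_unitInterval_fin_one
  have h2 : IsSemialgebraicFunOn ℚ {y : Fin 1 → ℝ | 0 < y 0 ∧ y 0 < 1} (fun y => 2 - y 0 ^ 2) :=
    (isSemialgebraicFunOn_aeval hG (2 - MvPolynomial.X 0 ^ 2 : MvPolynomial (Fin 1) ℚ)).congr
      fun x _ => by simp
  have hs : IsSemialgebraicFunOn ℚ {y : Fin 1 → ℝ | 0 < y 0 ∧ y 0 < 1}
      (fun y => Real.sqrt (2 - y 0 ^ 2)) :=
    IsSemialgebraicFunOn.sqrt_holds h2
  exact (hs.inv fun y hy => (Real.sqrt_pos.2 (discPlus_radicand_pos hy)).ne').congr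
    fun y _ => (one_div _).symm

/-- **The affine unfolding of the plus part of the disc integrand** (Kontsevich–Zagier rule 2;
registered sub-goal of the layer `CatalanTwoWays`, disc side, of `stub_boxRigidity` in dimension
two). With `a = √(2 − x²)`: for any representation `Dp` on the band-box `{0 < x < 1, 0 ≤ y ≤ 1}`
with integrand `1/(2a(a + y))` there and any representation `Mp` on the band
`{0 < x < 1, 1 ≤ t ≤ 1 + 1/a}` with integrand `(1/(2a))/t` there, `[Dp] − [Mp] ∈ relations`: the
substitution `t = 1 + y/a` along the last coordinate over the open base `(0,1)`
(`KZ.of_sub_of_mem_relations_of_affine`, `α = 1`, `β = 1/a`, Jacobian `β`) carries the band-box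
onto the band, and `((1/(2a))/(1 + y/a)) · (1/a) = 1/(2a(a + y))`.
[cite: KontsevichZagier2001, §1.2 rule (2)] -/
theorem discPlus_sub_logMonomial (Dp Mp : IntegralRep 2)
    (hDpd : Dp.domain = KZlog.band {y : Fin 1 → ℝ | 0 < y 0 ∧ y 0 < 1} (fun _ => (0:ℝ))
      (fun _ => (1:ℝ)))
    (hDpi : EqOn Dp.integrand
      (fun z => 1 / (2 * Real.sqrt (2 - z 0 ^ 2) * (Real.sqrt (2 - z 0 ^ 2) + z 1))) Dp.domain)
    (hMpd : Mp.domain = KZlog.band {y : Fin 1 → ℝ | 0 < y 0 ∧ y 0 < 1} (fun _ => (1:ℝ))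
      (fun y => 1 + 1 / Real.sqrt (2 - y 0 ^ 2)))
    (hMpi : EqOn Mp.integrand (fun z => (1 / (2 * Real.sqrt (2 - z 0 ^ 2))) / z 1) Mp.domain) :
    of Dp - of Mp ∈ relations := by
  -- the open base `G = (0,1) ⊆ ℝ¹`
  have hG : IsSemialgebraic ℚ {y : Fin 1 → ℝ | 0 < y 0 ∧ y 0 < 1} :=
    isSemialgebraic_unitInterval_fin_one
  have hGo : IsOpen {y : Fin 1 → ℝ | 0 < y 0 ∧ y 0 < 1} :=
    isOpen_Ioo.preimage (continuous_apply 0)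
  -- the coefficients `α = 1`, `β = 1/√(2 − x²)` of the substitution
  have hα : IsSemialgebraicFunOn ℚ {y : Fin 1 → ℝ | 0 < y 0 ∧ y 0 < 1} (fun _ => (1:ℝ)) := by
    simpa using isSemialgebraicFunOn_ratCast hG 1
  have hβd : DifferentiableOn ℝ (fun y : Fin 1 → ℝ => 1 / Real.sqrt (2 - y 0 ^ 2))
      {y : Fin 1 → ℝ | 0 < y 0 ∧ y 0 < 1} := by
    intro y hy
    have h1 : 2 - y 0 ^ 2 ≠ 0 := (discPlus_radicand_pos hy).ne'
    have h2 : Real.sqrt (2 - y 0 ^ 2) ≠ 0 := (Real.sqrt_pos.2 (discPlus_radicand_pos hy)).ne'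
    fun_prop (disch := assumption)
  have hβpos : ∀ y ∈ {y : Fin 1 → ℝ | 0 < y 0 ∧ y 0 < 1}, 0 < 1 / Real.sqrt (2 - y 0 ^ 2) :=
    fun y hy => one_div_pos.2 (Real.sqrt_pos.2 (discPlus_radicand_pos hy))
  -- the integrands match along the substitution `t = 1 + (1/√(2 − x²)) y`
  have key : ∀ z ∈ Dp.domain, Dp.integrand z =
      Mp.integrand (Fin.snoc (Fin.init z)
        (1 + 1 / Real.sqrt (2 - Fin.init z 0 ^ 2) * z (Fin.last 1))) *
        (1 / Real.sqrt (2 - Fin.init z 0 ^ 2)) := by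
    intro z hz
    have hz' := hz
    rw [hDpd] at hz'
    obtain ⟨hzG, h0, h1⟩ := KZlog.mem_band.1 hz'
    have h0' : 0 ≤ z (Fin.last 1) := h0
    have h1' : z (Fin.last 1) ≤ 1 := h1
    have ha : 0 < Real.sqrt (2 - Fin.init z 0 ^ 2) := Real.sqrt_pos.2 (discPlus_radicand_pos hzG)
    have hb : 0 ≤ 1 / Real.sqrt (2 - Fin.init z 0 ^ 2) := (hβpos _ hzG).le
    have hw : (Fin.snoc (Fin.init z) (1 + 1 / Real.sqrt (2 - Fin.init z 0 ^ 2) * z (Fin.last 1)) :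
        Fin 2 → ℝ) ∈ Mp.domain := by
      rw [hMpd]
      refine KZlog.mem_band.2 ?_
      rw [Fin.init_snoc, Fin.snoc_last]
      refine ⟨hzG, ?_, ?_⟩
      · show (1:ℝ) ≤ 1 + 1 / Real.sqrt (2 - Fin.init z 0 ^ 2) * z (Fin.last 1)
        nlinarith [mul_nonneg hb h0']
      · show 1 + 1 / Real.sqrt (2 - Fin.init z 0 ^ 2) * z (Fin.last 1) ≤
          1 + 1 / Real.sqrt (2 - Fin.init z 0 ^ 2)
        nlinarith [mul_le_mul_of_nonneg_left h1' hb]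
    rw [hDpi hz, hMpi hw]
    show 1 / (2 * Real.sqrt (2 - z 0 ^ 2) * (Real.sqrt (2 - z 0 ^ 2) + z 1)) =
      1 / (2 * Real.sqrt (2 - z 0 ^ 2)) / (1 + 1 / Real.sqrt (2 - z 0 ^ 2) * z 1) *
        (1 / Real.sqrt (2 - z 0 ^ 2))
    exact discPlus_affine_identity ha h0'
  exact of_sub_of_mem_relations_of_affine (m := 1) hGo (α := fun _ => (1:ℝ))
    (β := fun y => 1 / Real.sqrt (2 - y 0 ^ 2)) (a := fun _ => (0:ℝ)) (b := fun _ => (1:ℝ))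
    (a' := fun _ => (1:ℝ)) (b' := fun y => 1 + 1 / Real.sqrt (2 - y 0 ^ 2)) hα
    isSemialgebraicFunOn_one_div_sqrt_two_sub_sq (differentiableOn_const 1) hβd hβpos Dp Mp hDpd
    hMpd (fun y _ => by ring) (fun y _ => by ring) key

end Summit.KontsevichZagierPeriods.HurwitzMicroSectors.NormalFormPrinciple.PiBox.M2
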